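import Mathlib

/-!
# Crux `BirComplexStableXYR` (item `stmt-HubbardSuperconductivity-14845`): no Gaussian sign problem under (R)∧(P)

Structural lemma behind the restated engine's hypotheses (R) (time-reflection Hermiticity, which makes the imaginary
part of the action ODD under time reflection) and (P) (spatial-inversion evenness): on a finite abelian group (the
space-time torus `(ℤ/L)² × ℤ/M`), a translation-invariant real quadratic form `Q(θ) = Σ_{x,y} N(x,y) θ_x θ_y` that is
odd under a map `ρ` and even under a map `π` whose composite `π ∘ ρ` is a point inversion up to translation
(`π (ρ s) = a − s`; time reflection followed by spatial inversion is `s ↦ −s` up to the window offsets) VANISHES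
identically (`quadForm_eq_zero_of_odd_even`).  Applied to the quadratic Taylor part of `Im A` at a constant
configuration this says the spin-wave (Gaussian) covariance of an admissible table is REAL: the imaginary part of the
action starts at cubic order, which is perturbatively irrelevant at large `K` — the reason the (R)∧(P) class has no
Gaussian-level Beraha–Kahane–Weiss mechanism (standing disprover's analysis, `Cruxes/BirComplexStableXYR/Disproof.lean`
§4).  Pure finite algebra (reindexing sums by negation and translation); no definition is introduced. [folklore]
-/

namespace Summit.HubbardSuperconductivity.HubbardSuperconductivity.Theorems.BirComplexStableXYR.Negative

open scoped BigOperators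

variable {G : Type*} [AddCommGroup G] [Fintype G]


/-- A translation-invariant quadratic form is invariant under the point inversion `s ↦ −s`. -/
theorem transInv_quadForm_comp_neg (N : G → G → ℝ) (hN : ∀ x y z, N (x + z) (y + z) = N x y)
    (θ : G → ℝ) :
    (∑ x, ∑ y, N x y * (θ (-x) * θ (-y))) = ∑ x, ∑ y, N x y * (θ x * θ y) := by
  have key : ∀ x y, N (-x) (-y) = N y x := by
    intro x y
    have h := hN (-x) (-y) (x + y)
    rw [show -x + (x + y) = y by abel, show -y + (x + y) = x by abel] at h
    exact h.symm
  calc (∑ x, ∑ y, N x y * (θ (-x) * θ (-y)))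
      = ∑ x, ∑ y, N (-x) (-y) * (θ x * θ y) := by
        rw [← Equiv.sum_comp (Equiv.neg G)]
        refine Finset.sum_congr rfl fun x _ => ?_
        rw [← Equiv.sum_comp (Equiv.neg G)]
        refine Finset.sum_congr rfl fun y _ => ?_
        simp
    _ = ∑ x, ∑ y, N y x * (θ x * θ y) := by simp_rw [key]
    _ = ∑ y, ∑ x, N y x * (θ x * θ y) := Finset.sum_comm
    _ = ∑ x, ∑ y, N x y * (θ x * θ y) := by
        refine Finset.sum_congr rfl fun x _ => Finset.sum_congr rfl fun y _ => ?_
        ring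

/-- A translation-invariant quadratic form is invariant under translations of the field. -/
theorem transInv_quadForm_comp_add (N : G → G → ℝ) (hN : ∀ x y z, N (x + z) (y + z) = N x y)
    (θ : G → ℝ) (a : G) :
    (∑ x, ∑ y, N x y * (θ (a + x) * θ (a + y))) = ∑ x, ∑ y, N x y * (θ x * θ y) := by
  symm
  rw [← Equiv.sum_comp (Equiv.addLeft a)]
  refine Finset.sum_congr rfl fun x _ => ?_
  rw [← Equiv.sum_comp (Equiv.addLeft a)]
  refine Finset.sum_congr rfl fun y _ => ?_
  simp only [Equiv.coe_addLeft]
  rw [show a + x = x + a by abel, show a + y = y + a by abel, hN]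

/-- **No Gaussian sign problem under (R)∧(P).**  Let `Q(θ) = Σ_{x,y} N(x,y) θ_x θ_y` be a translation-invariant
real quadratic form on a finite abelian group (the space-time torus), `ρ` ("time reflection") and `π` ("spatial
inversion") two maps whose composite is a point inversion up to translation, `π (ρ s) = a − s`.  If `Q` is ODD
under `ρ` and EVEN under `π` then `Q ≡ 0`.  Applied to the quadratic Taylor part of `Im A` around a constant
configuration (odd under time reflection by (R), even under inversion by (P)), this is why the restated engine has a
REAL spin-wave covariance: the imaginary part of the action starts at cubic order. -/
theorem quadForm_eq_zero_of_odd_even (N : G → G → ℝ) (hN : ∀ x y z, N (x + z) (y + z) = N x y)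
    (ρ π : G → G) (a : G) (hcomp : ∀ s, π (ρ s) = a - s)
    (hodd : ∀ θ : G → ℝ, (∑ x, ∑ y, N x y * (θ (ρ x) * θ (ρ y))) = -∑ x, ∑ y, N x y * (θ x * θ y))
    (heven : ∀ θ : G → ℝ, (∑ x, ∑ y, N x y * (θ (π x) * θ (π y))) = ∑ x, ∑ y, N x y * (θ x * θ y))
    (θ : G → ℝ) :
    (∑ x, ∑ y, N x y * (θ x * θ y)) = 0 := by
  -- `s ↦ θ (a − s)` is `(θ ∘ π) ∘ ρ`, so its form is `−Q(θ ∘ π) = −Q(θ)` …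
  have h1 : (∑ x, ∑ y, N x y * (θ (a - x) * θ (a - y))) = -∑ x, ∑ y, N x y * (θ x * θ y) := by
    have := hodd (θ ∘ π)
    simp only [Function.comp, hcomp] at this
    rw [this, heven]
  -- … and it is also `θ_a ∘ neg` with `θ_a u = θ (a + u)`, whose form is `Q(θ_a) = Q(θ)`.
  have h2 : (∑ x, ∑ y, N x y * (θ (a - x) * θ (a - y))) = ∑ x, ∑ y, N x y * (θ x * θ y) := by
    have e1 := transInv_quadForm_comp_neg N hN (fun u => θ (a + u))
    have e2 := transInv_quadForm_comp_add N hN θ a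
    simp only [← sub_eq_add_neg] at e1
    rw [e1, e2]
  linarith


end Summit.HubbardSuperconductivity.HubbardSuperconductivity.Theorems.BirComplexStableXYR.Negative
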